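import Summits.CriticalPhenomena.PercolationContinuityZ3.Theorems.PercNearOneGluingNoHeavyLowerTailSahiConditioningPenalty
import Mathlib.Tactic.Linarith
import Mathlib.Tactic.Ring
import HarnessLib

/-!
# `NoHeavyLowerTail` (stmt-CriticalPhenomena-4575) — Sahi's `C₃` for a SANDWICHED slot: `f₁f₃ ≤ f₂ ≤ f₁ ∨ f₃`

Support file, seat `prim-l12-p5` (gen 3), `--supports stmt-CriticalPhenomena-4575`.  No definitions, no named facts, no sorries.

A triple of `{0,1}`-valued functions `(f, g, h)` is SANDWICHED if the middle slot lies between the meet and the join of the outer two: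
`f·h ≤ g ≤ f ∨ h` pointwise (for indicators of events: `A ∩ C ⊆ B ⊆ A ∪ C`).  Writing `a = E f`, `c = E h`, `t = E(fh)`, `U = E(fg)`, `V = E(gh)`
(so `E g = U + V − t` and `E(fgh) = t`), Sahi's third functional is, for ANY weight `μ`,

  **`E₃(f,g,h) = (t − ac)(2 − a − c + t) + (a − U)(c + t − ac) + (c − V)(a + t − ac)`**   (`sahiE_three_eq_of_sandwich`),

a sum of three products of nonnegative factors as soon as `μ` is an FKG probability weight and `f, h` are monotone (`t ≥ ac` is the FKG/Harris
inequality; `U ≤ a`, `V ≤ c`, `a, c ≤ 1`).  Hence: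

* **`sahiE_three_nonneg_of_sandwich`** — `E₃(f,g,h) ≥ 0` for every FKG probability weight on a finite distributive lattice and every monotone
  `{0,1}`-valued sandwiched triple: a case of Sahi's conjecture `C₃` (and, on product cubes, of Kahn's Conjecture 5) that is NOT covered by the
  comparable-pair / one-event-contains-the-other-two cases (e.g. `(x₀∨x₁, x₀∨x₁x₂∨x₁x₃∨x₂x₃, x₀∨x₂)` is a sandwiched antichain); it is the sub-shape
  `A∩C ⊆ B` of the union-containment shape `B ⊆ A∪C` singled out in `…SahiE3UnionContainment` as the first open one.  Quantitatively
  `E₃ ≥ Cov(f,h)·(1 + E[(1−f)(1−h)]) ≥ E g·Cov(f,h)` (`sahiE_three_ge_cov_of_sandwich`, `sahiE_three_ge_ex_mul_cov_of_sandwich`).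
* **`sectionSum_le_two_mul_sahiE_of_sandwich`** — on product cubes, combining with the conditioning penalty
  (`SahiSubsetChord.sectionSum_le_sahiE_add_slot`): for every coordinate set `S`, `Σ_v w_S(v)·E₃(sections at x_S = v) ≤ 2·E₃(f,g,h)` —
  the half-co-singleton bound HC and all its `|Sᶜ| ≥ 2` analogues hold on the sandwich class.
Exact check (seat, `code/sandwich_identity.py`, `code/sandwich.py`): identity on ~990 k (triple, weight) cells incl. non-FKG weights (0 failures);
`E₃ ≥ E g·Cov(f,h)` on all 571 684 sandwiched triples of `{0,1}^4` × 4 product weights (0 failures; ratio `E₃/min_a E f_a Cov(f_b,f_c) ≥ 1`,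
equality approached at `g = f ∨ h`, `E g → 1`); the inequality fails for non-FKG weights, as it must.
-/

namespace Summit.CriticalPhenomena.PercolationContinuityZ3.Theorems

namespace SahiSandwich

open Finset Literature.Combinatorics.Sahi2008

section Identity

variable {α : Type*} [Fintype α]

/-- **Sandwich identity** (any weight).  For `{0,1}`-valued `f, g, h` with `f·h ≤ g ≤ f + h` pointwise:
`E₃(f,g,h) = (t − ac)(2 − a − c + t) + (a − U)(c + t − ac) + (c − V)(a + t − ac)` with `a = E f`, `c = E h`, `t = E(fh)`, `U = E(fg)`,
`V = E(gh)`. [this file] -/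
theorem sahiE_three_eq_of_sandwich (μ : α → ℝ) (f g h : α → ℝ) (hf01 : ∀ x, f x = 0 ∨ f x = 1)
    (hg01 : ∀ x, g x = 0 ∨ g x = 1) (hh01 : ∀ x, h x = 0 ∨ h x = 1) (hlo : ∀ x, f x * h x ≤ g x)
    (hhi : ∀ x, g x ≤ f x + h x) :
    sahiE μ 3 ![f, g, h]
      = (ex μ (f * h) - ex μ f * ex μ h) * (2 - ex μ f - ex μ h + ex μ (f * h))
        + (ex μ f - ex μ (f * g)) * (ex μ h + ex μ (f * h) - ex μ f * ex μ h)
        + (ex μ h - ex μ (g * h)) * (ex μ f + ex μ (f * h) - ex μ f * ex μ h) := by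
  -- pointwise consequences of the sandwich on {0,1} values
  have hpt : ∀ x, f x * g x * h x = f x * h x ∧ g x = f x * g x + g x * h x - f x * h x := by
    intro x
    have h1 := hlo x; have h2 := hhi x
    rcases hf01 x with ef | ef <;> rcases hg01 x with eg | eg <;> rcases hh01 x with eh | eh <;>
      simp only [ef, eg, eh] at h1 h2 ⊢ <;> exact ⟨by linarith, by linarith⟩
  have hfgh : f * g * h = f * h := by
    funext x; simp only [Pi.mul_apply]; exact (hpt x).1
  have hg : ex μ g = ex μ (f * g) + ex μ (g * h) - ex μ (f * h) := by
    unfold ex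
    rw [← Finset.sum_add_distrib, ← Finset.sum_sub_distrib]
    refine Finset.sum_congr rfl fun x _ => ?_
    simp only [Pi.mul_apply]
    linear_combination (μ x) * (hpt x).2
  rw [sahiE_three_apply]
  simp only [Matrix.cons_val_zero, Matrix.cons_val_one, Matrix.head_cons, Matrix.cons_val_two, Matrix.tail_cons]
  rw [hfgh, hg]
  ring

end Identity

section FKG

variable {α : Type*} [DistribLattice α] [Fintype α]

/-- **Quantitative `C₃` for a sandwiched slot.**  For an FKG probability weight on a finite distributive lattice and monotone `{0,1}`-valued
`f, g, h` with `f·h ≤ g ≤ f + h`: `E₃(f,g,h) ≥ (E(fh) − E f·E h)·(2 − E f − E h + E(fh))`. [this file] -/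
theorem sahiE_three_ge_cov_of_sandwich {μ : α → ℝ} (hμ : IsFKGMeasure μ) (f g h : α → ℝ)
    (hf01 : ∀ x, f x = 0 ∨ f x = 1) (hg01 : ∀ x, g x = 0 ∨ g x = 1) (hh01 : ∀ x, h x = 0 ∨ h x = 1)
    (hfm : Monotone f) (hhm : Monotone h) (hlo : ∀ x, f x * h x ≤ g x) (hhi : ∀ x, g x ≤ f x + h x) :
    (ex μ (f * h) - ex μ f * ex μ h) * (2 - ex μ f - ex μ h + ex μ (f * h)) ≤ sahiE μ 3 ![f, g, h] := by
  have hf0 : ∀ x, 0 ≤ f x := fun x => by rcases hf01 x with e | e <;> simp [e]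
  have hf1 : ∀ x, f x ≤ 1 := fun x => by rcases hf01 x with e | e <;> simp [e]
  have hg0 : ∀ x, 0 ≤ g x := fun x => by rcases hg01 x with e | e <;> simp [e]
  have hg1 : ∀ x, g x ≤ 1 := fun x => by rcases hg01 x with e | e <;> simp [e]
  have hh0 : ∀ x, 0 ≤ h x := fun x => by rcases hh01 x with e | e <;> simp [e]
  have hh1 : ∀ x, h x ≤ 1 := fun x => by rcases hh01 x with e | e <;> simp [e]
  have hμ0 : ∀ x, 0 ≤ μ x := hμ.nonneg
  rw [sahiE_three_eq_of_sandwich μ f g h hf01 hg01 hh01 hlo hhi]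
  -- signs of the factors
  have hHarris : ex μ f * ex μ h ≤ ex μ (f * h) := ex_mul_ex_le_ex_mul hμ hf0 hh0 hfm hhm
  have ha0 : 0 ≤ ex μ f := ex_nonneg hμ0 hf0
  have hc0 : 0 ≤ ex μ h := ex_nonneg hμ0 hh0
  have ha1 : ex μ f ≤ 1 := by have := ex_mono (μ := μ) hμ0 hf1; rwa [ex_const hμ.sum_eq_one] at this
  have hc1 : ex μ h ≤ 1 := by have := ex_mono (μ := μ) hμ0 hh1; rwa [ex_const hμ.sum_eq_one] at this
  have ht0 : 0 ≤ ex μ (f * h) := ex_nonneg hμ0 fun x => mul_nonneg (hf0 x) (hh0 x)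
  have hU : ex μ (f * g) ≤ ex μ f := ex_mono hμ0 fun x => by
    simpa [Pi.mul_apply] using mul_le_of_le_one_right (hf0 x) (hg1 x)
  have hV : ex μ (g * h) ≤ ex μ h := ex_mono hμ0 fun x => by
    simpa [Pi.mul_apply] using mul_le_of_le_one_left (hh0 x) (hg1 x)
  have t1 : 0 ≤ (ex μ f - ex μ (f * g)) * (ex μ h + ex μ (f * h) - ex μ f * ex μ h) :=
    mul_nonneg (sub_nonneg.mpr hU) (by nlinarith [hc0, ha1, ht0])
  have t2 : 0 ≤ (ex μ h - ex μ (g * h)) * (ex μ f + ex μ (f * h) - ex μ f * ex μ h) :=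
    mul_nonneg (sub_nonneg.mpr hV) (by nlinarith [ha0, hc1, ht0])
  linarith [t1, t2]

/-- **Sahi's `C₃` for a sandwiched slot.**  For an FKG probability weight on a finite distributive lattice and monotone `{0,1}`-valued
`f, g, h` with `f·h ≤ g ≤ f + h` pointwise (events: `A ∩ C ⊆ B ⊆ A ∪ C`): `E₃(f,g,h) ≥ 0`. [this file] -/
theorem sahiE_three_nonneg_of_sandwich {μ : α → ℝ} (hμ : IsFKGMeasure μ) (f g h : α → ℝ)
    (hf01 : ∀ x, f x = 0 ∨ f x = 1) (hg01 : ∀ x, g x = 0 ∨ g x = 1) (hh01 : ∀ x, h x = 0 ∨ h x = 1)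
    (hfm : Monotone f) (hhm : Monotone h) (hlo : ∀ x, f x * h x ≤ g x) (hhi : ∀ x, g x ≤ f x + h x) :
    0 ≤ sahiE μ 3 ![f, g, h] := by
  have hf0 : ∀ x, 0 ≤ f x := fun x => by rcases hf01 x with e | e <;> simp [e]
  have hf1 : ∀ x, f x ≤ 1 := fun x => by rcases hf01 x with e | e <;> simp [e]
  have hh0 : ∀ x, 0 ≤ h x := fun x => by rcases hh01 x with e | e <;> simp [e]
  have hh1 : ∀ x, h x ≤ 1 := fun x => by rcases hh01 x with e | e <;> simp [e]
  have hμ0 : ∀ x, 0 ≤ μ x := hμ.nonneg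
  have key := sahiE_three_ge_cov_of_sandwich hμ f g h hf01 hg01 hh01 hfm hhm hlo hhi
  have hHarris : ex μ f * ex μ h ≤ ex μ (f * h) := ex_mul_ex_le_ex_mul hμ hf0 hh0 hfm hhm
  have ha1 : ex μ f ≤ 1 := by have := ex_mono (μ := μ) hμ0 hf1; rwa [ex_const hμ.sum_eq_one] at this
  have hc1 : ex μ h ≤ 1 := by have := ex_mono (μ := μ) hμ0 hh1; rwa [ex_const hμ.sum_eq_one] at this
  have ht0 : 0 ≤ ex μ (f * h) := ex_nonneg hμ0 fun x => mul_nonneg (hf0 x) (hh0 x)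
  have : 0 ≤ (ex μ (f * h) - ex μ f * ex μ h) * (2 - ex μ f - ex μ h + ex μ (f * h)) :=
    mul_nonneg (sub_nonneg.mpr hHarris) (by linarith)
  linarith

/-- On the sandwich class `E₃` dominates the mean-weighted outer covariance: `E g·(E(fh) − E f·E h) ≤ E₃(f,g,h)`. [this file] -/
theorem sahiE_three_ge_ex_mul_cov_of_sandwich {μ : α → ℝ} (hμ : IsFKGMeasure μ) (f g h : α → ℝ)
    (hf01 : ∀ x, f x = 0 ∨ f x = 1) (hg01 : ∀ x, g x = 0 ∨ g x = 1) (hh01 : ∀ x, h x = 0 ∨ h x = 1)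
    (hfm : Monotone f) (hhm : Monotone h) (hlo : ∀ x, f x * h x ≤ g x) (hhi : ∀ x, g x ≤ f x + h x) :
    ex μ g * (ex μ (f * h) - ex μ f * ex μ h) ≤ sahiE μ 3 ![f, g, h] := by
  have hf0 : ∀ x, 0 ≤ f x := fun x => by rcases hf01 x with e | e <;> simp [e]
  have hf1 : ∀ x, f x ≤ 1 := fun x => by rcases hf01 x with e | e <;> simp [e]
  have hg1 : ∀ x, g x ≤ 1 := fun x => by rcases hg01 x with e | e <;> simp [e]
  have hh0 : ∀ x, 0 ≤ h x := fun x => by rcases hh01 x with e | e <;> simp [e]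
  have hh1 : ∀ x, h x ≤ 1 := fun x => by rcases hh01 x with e | e <;> simp [e]
  have hμ0 : ∀ x, 0 ≤ μ x := hμ.nonneg
  have key := sahiE_three_ge_cov_of_sandwich hμ f g h hf01 hg01 hh01 hfm hhm hlo hhi
  have hHarris : ex μ f * ex μ h ≤ ex μ (f * h) := ex_mul_ex_le_ex_mul hμ hf0 hh0 hfm hhm
  have ha1 : ex μ f ≤ 1 := by have := ex_mono (μ := μ) hμ0 hf1; rwa [ex_const hμ.sum_eq_one] at this
  have hc1 : ex μ h ≤ 1 := by have := ex_mono (μ := μ) hμ0 hh1; rwa [ex_const hμ.sum_eq_one] at this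
  have hb1 : ex μ g ≤ 1 := by have := ex_mono (μ := μ) hμ0 hg1; rwa [ex_const hμ.sum_eq_one] at this
  have ht0 : 0 ≤ ex μ (f * h) := ex_nonneg hμ0 fun x => mul_nonneg (hf0 x) (hh0 x)
  -- E g ≤ 1 ≤ 2 − a − c + t  (the second inequality is `E[f ∨ h] ≤ 1`)
  have hunion : ex μ f + ex μ h - ex μ (f * h) ≤ 1 := by
    have hpt : ∀ x, (fun x => f x + h x - f x * h x) x ≤ (fun _ => (1 : ℝ)) x := fun x => by
      rcases hf01 x with e | e <;> rcases hh01 x with e' | e' <;> simp only [e, e'] <;> norm_num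
    have hle := ex_mono (μ := μ) hμ0 hpt
    rw [ex_const hμ.sum_eq_one] at hle
    have e : ex μ (fun x => f x + h x - f x * h x) = ex μ f + ex μ h - ex μ (f * h) := by
      unfold ex
      rw [← Finset.sum_add_distrib, ← Finset.sum_sub_distrib]
      exact Finset.sum_congr rfl fun x _ => by simp only [Pi.mul_apply]; ring
    linarith [hle, e]
  have hcoef : ex μ g ≤ 2 - ex μ f - ex μ h + ex μ (f * h) := by linarith [hunion, hb1]
  have := mul_le_mul_of_nonneg_left hcoef (sub_nonneg.mpr hHarris)
  linarith [this, key]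

end FKG

section Cube

open SahiSubsetChord

variable {ι : Type*} [Fintype ι] [DecidableEq ι]

/-- **HC and all its `|Sᶜ| ≥ 2` analogues on the sandwich class.**  For a product weight on a finite cube, monotone `{0,1}`-valued
`f, g, h` with `f·h ≤ g ≤ f + h` and every coordinate set `S`: `Σ_v w_S(v)·E₃(sections at x_S = v) ≤ 2·E₃(f,g,h)`. [this file] -/
theorem sectionSum_le_two_mul_sahiE_of_sandwich (q : ι → ℝ) (hq : ∀ i, 0 ≤ q i ∧ q i ≤ 1) (f g h : (ι → Bool) → ℝ)
    (hf01 : ∀ x, f x = 0 ∨ f x = 1) (hg01 : ∀ x, g x = 0 ∨ g x = 1) (hh01 : ∀ x, h x = 0 ∨ h x = 1)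
    (hfm : Monotone f) (hgm : Monotone g) (hhm : Monotone h) (hlo : ∀ x, f x * h x ≤ g x) (hhi : ∀ x, g x ≤ f x + h x)
    (S : Finset ι) :
    ∑ v : ({i // i ∈ S} → Bool), prodWeight (fun i : {i // i ∈ S} => q i) v *
        sahiE (prodWeight fun i : {i // i ∉ S} => q i) 3
          (fun a y => (![f, g, h] : Fin 3 → (ι → Bool) → ℝ) a (glue S v y))
      ≤ 2 * sahiE (prodWeight q) 3 ![f, g, h] := by
  have hF0 : ∀ a x, 0 ≤ (![f, g, h] : Fin 3 → (ι → Bool) → ℝ) a x := by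
    intro a x; fin_cases a
    · rcases hf01 x with e | e <;> simp [e]
    · rcases hg01 x with e | e <;> simp [e]
    · rcases hh01 x with e | e <;> simp [e]
  have hFm : ∀ a, Monotone ((![f, g, h] : Fin 3 → (ι → Bool) → ℝ) a) := by
    intro a; fin_cases a
    · exact hfm
    · exact hgm
    · exact hhm
  -- conditioning penalty with the middle slot distinguished
  have key := sectionSum_le_sahiE_add_slot q hq (![f, g, h] : Fin 3 → (ι → Bool) → ℝ) hF0 hFm (Equiv.swap 0 1) S
  rw [show (Equiv.swap (0 : Fin 3) 1) 0 = 1 by decide, show (Equiv.swap (0 : Fin 3) 1) 1 = 0 by decide,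
    show (Equiv.swap (0 : Fin 3) 1) 2 = 2 by decide] at key
  simp only [Matrix.cons_val_zero, Matrix.cons_val_one, Matrix.head_cons, Matrix.cons_val_two, Matrix.tail_cons] at key
  -- E g · Cov(f,h) ≤ E₃ on the sandwich class (product weights are FKG)
  have hFKG : IsFKGMeasure (prodWeight q) := isFKGMeasure_coinWeight hq
  have hb := sahiE_three_ge_ex_mul_cov_of_sandwich hFKG f g h hf01 hg01 hh01 hfm hhm hlo hhi
  linarith [key, hb]

end Cube

end SahiSandwich

end Summit.CriticalPhenomena.PercolationContinuityZ3.Theorems
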